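import Summits.QuantumFields.YangMills.Theorems.BalabanUVNodesN22AtRecordOfGenAnalytic
import Summits.QuantumFields.YangMills.Theorems.BalabanUVNodesN22GenAnalyticReadingNonexpansive

/-!
# BalabanUVNodes ∕ node N22 = NE9 — ROAD 2 AT THE RECORD FROM A NON-EXPANSIVE ANALYTIC READING, UNDER THE LETTER BLOCK's STANDING ROWS: K3's `h9`, the kernel-face socket and
# the pin face from node N18's kernel step rate + analyticity of node00-def-W1's one-step map (older terms: Banach ball with margin ratio `4M_b c_w∕ϱ < 1`; last coupling: sectors)
# + (Adm-run) + readings ∕ law ∕ (1.21) — NO growth rate, row `ℓ.θ₅ ≤ ℓ.ω²` as it stands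

Cell `pub-ymgap`, HUMAN RULING D-0062 (Track A), R134 seat `pub-ymgap-dag-n22-c` (strategy s1), generation 18, module J63.  THEOREMS ONLY (no `def`, no `sorry`, standard axioms);
`--kind proof --supports stmt-QuantumFields-27366 --as helper` (K3⁸ `SpineGivenEndpointR13SepCoPHV`), COUNT-NEUTRAL.  Imports module J60 `…N22AtRecordOfGenAnalytic` (its §0 output
bound from (AR); through it J59 §2's last-coupling theorems, J46's `ne9_EA_objectsOfRecord₁₃_of_kernelStepRate_termSecondDiff_outputBound`, dag-n22-w3's socket ∕ pin forms) and
module J62 `…N22GenAnalyticReadingNonexpansive` (the UNIFORM letter).  Nothing re-declared; §1 is ONE application of J46 §1b, §2–§3 one application of §1 each.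

WHY.  Modules J58–J60 close K3's `h9` on ROAD 2 from analyticity with the rows `ℓ.θ₅·ν ≤ ℓ.ω²`, `ν > ω₁ + 4M_b c_w∕ϱ`, `ν ≥ (ω₁ + 4M_b c_w∕ϱ)²` (the SUM-channel recursion's growth).
Module J62 shows that a NON-EXPANSIVE analytic reading (`4M_b c_w∕ϱ < 1`, uniform age weights `aw ≤ c_w`) gives UNIFORM second-difference letters directly; THIS FILE reads that at the
record through module J46's `q = 1` edition: the inputs are node N18's `KernelStepRateOfRecord₁₃`; per torus the analytic reading (AR) of J57∕J58 with `aw K k j ≤ c_w` and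
**`4M_b c_w∕ϱ < 1`**; SECTOR holomorphy of the one-step map in its complex last coupling with the centred quadratic bound (J59 §2: `ℓ₁ = B_qγ∕c_S`, `ℓ₂ = (6c_S²+32c_S+64)∕c_S²·B_q`);
(Adm-run) (the output bound then follows, J60 §0); term holomorphy through the readings ∕ chart ∕ space clause ∕ site-weight tails at the run towers; W1-20's law; (1.21); and the
letter block's STANDING rows **`ℓ.θ₅ ≤ ℓ.ω²`**, `ℓ.κ ≤ δ₁`, `δ₁ ≤ κ₅`, the `C₉` row at `M₂ = max ℓ₂ (64M_b c_w²ℓ₁²∕(ϱ²(1 − 4M_b c_w∕ϱ)))`, `B = M_b`.  ⟹ §1 ★★★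
`ne9_EA_objectsOfRecord₁₃_of_kernelStepRate_genAnalyticNonexpansive` (K3's `h9`), §2 ★★★ `n22At_u3OfRecord₁₃_of_kernelStepRate_genAnalyticNonexpansive` (dag-n27-c's `h22` row),
§3 ★★★ `n22At_rateCarriers_of_kernels_pin_of_kernelStepRate_genAnalyticNonexpansive` (pin face).  THE N22 ROW SENTENCE in this currency: «node N18's kernel step rate of record +
a NON-EXPANSIVE analytic reading of def-W1's one-step map in the older terms (margin at least four output bounds in channel units) + sector analyticity in the last coupling +
generated runs admissible + readings ∕ tails ∕ law ∕ (1.21) ⇒ §2b `h9` ∕ `N22At` under the letter block's standing rows — N18's rate is NOT coupled to the recursion's constants».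

HONEST FRAMING (binding).  Count-neutral COMPOSITION; every input a DISPLAYED HYPOTHESIS ((AR) and the sector datum are the cell's readings of [II] (2.14)–(2.15) p. 15 and [I]
p. 263 ∕ p. 266 — GAPS G-ne9p2-5, G-t4-U3-1∕-3; the margin clause is of the printed TYPE «ε₁ sufficiently small», [II] p. 18, under the cell's units, not a printed inequality;
producer: node N09 ∕ N10 ∕ NODE A on def-T's generator of record; inhabited by every generator constant in `(z, old)` — A5, conditional content); NO estimate of Bałaban's is
proved or asserted; nothing of the record is constructed or claimed to meet the displayed inputs.  N22 is NOT discharged (typed 28∕28 · discharged 5∕27 UNCHANGED); K3⁸ OPEN and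
NOT claimed (no stub of 27366 touched); NE9 is NOT IN PRINT for d = 4; no count claim; one finite 𝕋⁴ programme at fixed ε — R4 closes the CONDITIONAL rung `BalabanLadder.UV`
only; NOTHING about the continuum limit, ℝ⁴, infinite volume, OS axioms, a mass gap or the Clay problem is proved or claimed.  References (TYPES only): [I] = Bałaban, CMP 109
(1987) (0.23) p. 256, §1 p. 263, p. 266, (2.12)–(2.13) p. 268, p. 282, §5 p. 298; [II] = CMP 116 (1988) (1.41) p. 11, (2.13)–(2.15) pp. 14–15, p. 18, (2.41) p. 21; King, CMP 102
(1986) Lemma 4.5 (4.38).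
-/

noncomputable section

open Set Metric
open scoped BigOperators

namespace YMDAG.N22.KernelFading

open Literature.MathematicalPhysics.QuantumFieldTheory.Balaban1983to89
open Literature.MathematicalPhysics.QuantumFieldTheory.Balaban1983to89.T4Continuum (T4Family ULoop)
open Literature.MathematicalPhysics.QuantumFieldTheory.Balaban1983to89.T4OutputRate (Window NE9)
open Literature.MathematicalPhysics.QuantumFieldTheory.Balaban1983to89.TreeLengthTorus (TPt)
open Literature.MathematicalPhysics.QuantumFieldTheory.Balaban1983to89.B12TreeDecay (K₀ kappa₀)
open Literature.MathematicalPhysics.QuantumFieldTheory.Balaban1983to89.B12Decay510 (delta1)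
open Literature.MathematicalPhysics.QuantumFieldTheory.Balaban1983to89.B12Decay510Window (K₁)
open Literature.MathematicalPhysics.QuantumFieldTheory.Balaban1983to89.B12Decay510Torus (distCT nearT)
open Literature.MathematicalPhysics.QuantumFieldTheory.Balaban1983to89.Node00 (Stage13Params Stage13HParams U3Letters₁₁ MatA)
open Literature.MathematicalPhysics.QuantumFieldTheory.Balaban1983to89.Node00.Sect2 (domSys domCount CPair)
open Literature.MathematicalPhysics.QuantumFieldTheory.Balaban1983to89.Node00.W1
open Literature.MathematicalPhysics.QuantumFieldTheory.Balaban1983to89.Node00.LocalizedSum17 (ReadingMaps Localizes17OfRecord₁₃)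
open Literature.MathematicalPhysics.QuantumFieldTheory.Balaban1983to89.Node00.U3OfKernels (histPrefix objectsOfRecord₁₃)
open Literature.MathematicalPhysics.QuantumFieldTheory.Balaban1983to89.Node00.U3KernelLetters (KernelStepRateOfRecord₁₃ PolLimitsExistOfRecord₁₃)
open YMDAG.UVSplit (N22At u3OfRecord₁₃ RateReading₁₃CoPH rateCarriersOfRecord₁₃CoPH)
open YMDAG.N22.AtKernels (n22At_rateCarriers_of_kernels_pin_of_ne9 n22At_u3OfRecord₁₃_objectsOfRecord₁₃_iff)
open YMDAG.N22.TermRecursion (genT1last_of_lastSectorHolo genT2last_of_lastSectorHolo outputBound_truncRun_toClusterTower_of_analyticReading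
  termSecondDiffAt_box_truncRun_toClusterTower_of_analyticReadingNonexpansive)

open scoped Matrix.Norms.L2Operator

variable (F : T4Family) (N : ℕ) [NeZero N] {𝔸 : Type} {M : ℕ}

/-! ## §1 ★★★ K3's `h9` on ROAD 2 from a non-expansive analytic reading, under the standing rows -/

open Classical Finset in
/-- ★★★ **K3's `h9` ON ROAD 2 FROM A NON-EXPANSIVE ANALYTIC READING — NO GROWTH RATE, THE STANDING ROW `ℓ.θ₅ ≤ ℓ.ω²`.**  N18's `KernelStepRateOfRecord₁₃ F N θ κ₅ ℓ.θ₅ C₅`; per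
torus the analytic reading of def-W1's one-step map in the older terms (`Pot K k`, `ρA`, `A` holomorphic with `‖A‖ ≤ M_b·e^{−κ_E d}` on `ball 0 R`, `‖ρA old‖ ≤ r₀ < R − ϱ`,
sup-type dominations with UNIFORM age weights `0 ≤ aw K k j ≤ c_w`) with the NON-EXPANSIVE margin **`4M_b c_w∕ϱ < 1`**; sector holomorphy in the complex last coupling with the
centred quadratic bound (`O K ⊇ closedBall s (c_S s)`, `‖E(z) − V‖ ≤ B_q e^{−κ_E d} s²`); (Adm-run); term holomorphy through the readings ∕ chart ∕ space clause ∕ tails at the run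
towers; W1-20's law; (1.21); rows `ℓ.θ₅ ≤ ℓ.ω²`, `ℓ.κ ≤ δ₁ ≤ κ₅`, the `C₉` row at `M₂ = max ℓ₂ (64M_b c_w²ℓ₁²∕(ϱ²(1 − 4M_b c_w∕ϱ)))`, `ℓ₁ = B_qγ∕c_S`, `ℓ₂ = (6c_S²+32c_S+64)∕c_S²·B_q`
⟹ **`NE9 ((objectsOfRecord₁₃ F N θ ℓ).EA 0) (Window θ.γ) ℓ.κ ℓ.moduli`** — module J62 §3 at every torus is J46 §1b's `hΔ` (uniform `M₂`), J60 §0 its `hbd`.  LOCATED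
(hypothesis form); N22 NOT discharged. [folklore] -/
theorem ne9_EA_objectsOfRecord₁₃_of_kernelStepRate_genAnalyticNonexpansive (θ : Stage13Params F N) (ℓ : U3Letters₁₁) (hs : ℓ.Signs) (hγ : 0 < θ.γ)
    (hlim : PolLimitsExistOfRecord₁₃ F N θ) {κ₅ C₅ : ℝ} (hC₅ : 0 ≤ C₅) (h5 : KernelStepRateOfRecord₁₃ F N θ κ₅ ℓ.θ₅ C₅)
    (m' : ℕ) (M : ℕ) [NeZero M] (hM : M = F.L ^ m')
    (Gn : (K : ℕ) → GenTower (F.P K) 𝔸 M) (emb : ReadingMaps F (MatA N) 𝔸)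
    (hloc : Localizes17OfRecord₁₃ F N θ (fun K => truncRun K (toClusterTower (Gn K))) emb)
    (sp : (K k : ℕ) → (domSys (F.P K) M (k + 1)).Dom → Set (CPair (F.P K) 𝔸))
    {κ κE δ₀ B₃ r R r₀ ϱ Mb cw cS Bq : ℝ} {aw : ℕ → ℕ → ℕ → ℝ}
    (hκ₀ : kappa₀ (4 * 2 ^ 4) (2 * 4) ≤ κ / 2) (hδ₀ : 0 < δ₀) (hB₃ : 0 ≤ B₃) (hr : 0 < r) (hκE : κ ≤ κE)
    (Adm : (K k : ℕ) → OlderTerms (F.P K) 𝔸 M k → Prop)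
    (hAdm : ∀ K, ∀ g ∈ Window θ.γ, ∀ k, Adm K k (olderOf (recTerm (Gn K) fun n => ((g n : ℝ) : ℂ)) k))
    {Pot : ℕ → ℕ → Type*} [∀ K k, NormedAddCommGroup (Pot K k)] [∀ K k, NormedSpace ℂ (Pot K k)]
    (ρA : (K k : ℕ) → OlderTerms (F.P K) 𝔸 M k → Pot K k) (A : (K k : ℕ) → ℝ → CPair (F.P K) 𝔸 → (domSys (F.P K) M (k + 1)).Dom → Pot K k → ℂ)
    (hGA : ∀ (K k : ℕ), ∀ t ∈ Ioc (0 : ℝ) θ.γ, ∀ (old : OlderTerms (F.P K) 𝔸 M k), Adm K k old → ∀ (X : (domSys (F.P K) M (k + 1)).Dom), ∀ φ ∈ sp K k X,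
      ((Gn K) k).E ((t : ℝ) : ℂ) old φ X = A K k t φ X (ρA K k old))
    (hA : ∀ (K k : ℕ), ∀ t ∈ Ioc (0 : ℝ) θ.γ, ∀ (X : (domSys (F.P K) M (k + 1)).Dom), ∀ φ ∈ sp K k X, DifferentiableOn ℂ (A K k t φ X) (ball 0 R))
    (hMbA : ∀ (K k : ℕ), ∀ t ∈ Ioc (0 : ℝ) θ.γ, ∀ (X : (domSys (F.P K) M (k + 1)).Dom), ∀ φ ∈ sp K k X, ∀ p ∈ ball (0 : Pot K k) R,
      ‖A K k t φ X p‖ ≤ Mb * Real.exp (-(κE * (domSys (F.P K) M (k + 1)).dj X)))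
    (hAdmr : ∀ (K k : ℕ) (old : OlderTerms (F.P K) 𝔸 M k), Adm K k old → ‖ρA K k old‖ ≤ r₀)
    (hρ₁ : ∀ (K k : ℕ) (o o' : OlderTerms (F.P K) 𝔸 M k), Adm K k o → Adm K k o' → ∀ (B' : ℝ), 0 ≤ B' →
      (∀ (k' : ℕ) (hk' : k' < k) (Y : (domSys (F.P K) M (k' + 1)).Dom), ∀ φ' ∈ sp K k' Y,
        aw K k (k' + 1) * (Real.exp (κE * (domSys (F.P K) M (k' + 1)).dj Y) * ‖o ⟨k' + 1, Nat.succ_lt_succ hk'⟩ Y φ' - o' ⟨k' + 1, Nat.succ_lt_succ hk'⟩ Y φ'‖) ≤ B') →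
      ‖ρA K k o - ρA K k o'‖ ≤ B')
    (hρ₂ : ∀ (K k : ℕ) (o₁ o₂ o₃ : OlderTerms (F.P K) 𝔸 M k), Adm K k o₁ → Adm K k o₂ → Adm K k o₃ → ∀ (B' : ℝ), 0 ≤ B' →
      (∀ (k' : ℕ) (hk' : k' < k) (Y : (domSys (F.P K) M (k' + 1)).Dom), ∀ φ' ∈ sp K k' Y,
        aw K k (k' + 1) * (Real.exp (κE * (domSys (F.P K) M (k' + 1)).dj Y) *
          ‖o₁ ⟨k' + 1, Nat.succ_lt_succ hk'⟩ Y φ' - 2 * o₂ ⟨k' + 1, Nat.succ_lt_succ hk'⟩ Y φ' + o₃ ⟨k' + 1, Nat.succ_lt_succ hk'⟩ Y φ'‖) ≤ B') →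
      ‖ρA K k o₁ - (2 : ℂ) • ρA K k o₂ + ρA K k o₃‖ ≤ B')
    (haw : ∀ K k j, 0 ≤ aw K k j) (hawcw : ∀ K k j, aw K k j ≤ cw) (hC1 : 4 * Mb * cw / ϱ < 1)
    (hMb0 : 0 ≤ Mb) (hϱ : 0 < ϱ) (hR : r₀ + ϱ < R)
    (O : ℕ → Set ℂ) (V : (K k : ℕ) → OlderTerms (F.P K) 𝔸 M k → CPair (F.P K) 𝔸 → (domSys (F.P K) M (k + 1)).Dom → ℂ) (hcS : 0 < cS) (hBq : 0 ≤ Bq)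
    (hballS : ∀ K, ∀ s ∈ Ioc (0 : ℝ) θ.γ, closedBall (s : ℂ) (cS * s) ⊆ O K)
    (hholS : ∀ (K k : ℕ) (old : OlderTerms (F.P K) 𝔸 M k), Adm K k old → ∀ (X : (domSys (F.P K) M (k + 1)).Dom), ∀ φ ∈ sp K k X,
      DifferentiableOn ℂ (fun z => ((Gn K) k).E z old φ X) (O K))
    (hbdS : ∀ (K k : ℕ) (old : OlderTerms (F.P K) 𝔸 M k), Adm K k old → ∀ (X : (domSys (F.P K) M (k + 1)).Dom), ∀ φ ∈ sp K k X, ∀ s ∈ Ioc (0 : ℝ) θ.γ,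
      ∀ z ∈ closedBall (s : ℂ) (cS * s), ‖((Gn K) k).E z old φ X - V K k old φ X‖ ≤ Bq * Real.exp (-(κE * (domSys (F.P K) M (k + 1)).dj X)) * s ^ 2)
    (Ec : ℕ → ℕ → Type*) [∀ K k, NormedAddCommGroup (Ec K k)] [∀ K k, NormedSpace ℂ (Ec K k)]
    (ι : letI := θ.instVβ₁; letI := θ.instVβ₂
      (K k : ℕ) → (domSys (F.P K) M (k + 1)).Dom → ((Fin (F.P K).d → Site (F.P K) (k + 1) → θ.Vβ) →L[ℝ] Ec K k))
    (Φ : (K k : ℕ) → (domSys (F.P K) M (k + 1)).Dom → Ec K k → CPair (F.P K) 𝔸)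
    (U : (K k : ℕ) → (domSys (F.P K) M (k + 1)).Dom → Set (Ec K k)) (hU : ∀ K k X, IsOpen (U K k X)) (hrU : ∀ K k X, ball (0 : Ec K k) r ⊆ U K k X)
    (hEhol : ∀ g ∈ Window θ.γ, ∀ (K k : ℕ) (X : (domSys (F.P K) M (k + 1)).Dom),
      DifferentiableOn ℂ (fun z => (truncRun K (toClusterTower (Gn K)) k).E (histPrefix g k) (Φ K k X z) X) (U K k X))
    (hΦemb : letI := θ.instVβ₁; letI := θ.instVβ₂
      ∀ (K k : ℕ) (X : (domSys (F.P K) M (k + 1)).Dom) (Bf : Fin (F.P K).d → Site (F.P K) (k + 1) → θ.Vβ),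
        Φ K k X (ι K k X Bf) = emb K k (fun l t => NormedSpace.exp (θ.ρ8 (Bf l t))))
    (hΦsp : ∀ (K k : ℕ) (X : (domSys (F.P K) M (k + 1)).Dom), ∀ z ∈ ball (0 : Ec K k) r, Φ K k X z ∈ sp K k X)
    (w : (K k : ℕ) → (domSys (F.P K) M (k + 1)).Dom → Site (F.P K) (k + 1) → ℝ) (hw₀ : ∀ K k X t, 0 ≤ w K k X t)
    (hw : letI := θ.instVβ₁; letI := θ.instVβ₂; letI := θ.instιβ
      ∀ (K k : ℕ) (X : (domSys (F.P K) M (k + 1)).Dom) (l : Fin (F.P K).d) (t : Site (F.P K) (k + 1)) (c : θ.ιβ),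
        ‖ι K k X (Pi.single l (Pi.single t (θ.bV c)))‖ ≤ w K k X t)
    (htail : ∀ (K k : ℕ) (X : (domSys (F.P K) M (k + 1)).Dom) (t : Site (F.P K) (k + 1)),
      let e : Site (F.P K) (k + 1) → TPt 4 (domCount (F.P K) M (k + 1) * M) := fun x i => (ZMod.cast (x i) : ZMod (domCount (F.P K) M (k + 1) * M))
      w K k X t ≤ B₃ * Real.exp (-δ₀ * distCT (domCount (F.P K) M (k + 1)) M (e t) (nearT (M := M) (e t) X)))
    (hκ₅ : delta1 δ₀ κ ((M : ℝ) * 4) ≤ κ₅)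
    (hω : 0 < ℓ.ω) (hθω : ℓ.θ₅ ≤ ℓ.ω ^ 2) (hℓκ : ℓ.κ ≤ delta1 δ₀ κ ((M : ℝ) * 4))
    (hC₉ : (4 * (2 * C₅ / (1 - ℓ.θ₅) + 2 * ((16 * Mb * B₃ ^ 2 / r ^ 2) * Real.exp (delta1 δ₀ κ ((M : ℝ) * 4) * ((M : ℝ) * 4) * 3) * K₀ (4 * 2 ^ 4) (2 * 4) * K₁ 4 (δ₀ / 2))) / θ.γ +
        ((16 * max ((6 * cS ^ 2 + 32 * cS + 64) / cS ^ 2 * Bq) (64 * Mb * cw ^ 2 / ϱ ^ 2 * (Bq * θ.γ / cS) ^ 2 / (1 - 4 * Mb * cw / ϱ)) * B₃ ^ 2 / r ^ 2) * Real.exp (delta1 δ₀ κ ((M : ℝ) * 4) * ((M : ℝ) * 4) * 3) * K₀ (4 * 2 ^ 4) (2 * 4) *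
          K₁ 4 (δ₀ / 2)) * θ.γ / 2) / ℓ.ω ≤ ℓ.C₉) :
    NE9 ((objectsOfRecord₁₃ F N θ ℓ).EA 0) (Window θ.γ) ℓ.κ ℓ.moduli := by
  -- module J62 at every torus: the UNIFORM letter `hΔ` (last-coupling schemas by J59 §2's sector typing); module J60 §0: the output bound from (AR) + (Adm-run)
  have hℓ₁ : 0 ≤ Bq * θ.γ / cS := by positivity
  have hℓ₂ : 0 ≤ (6 * cS ^ 2 + 32 * cS + 64) / cS ^ 2 * Bq := by positivity
  have hM₂ : 0 ≤ max ((6 * cS ^ 2 + 32 * cS + 64) / cS ^ 2 * Bq) (64 * Mb * cw ^ 2 / ϱ ^ 2 * (Bq * θ.γ / cS) ^ 2 / (1 - 4 * Mb * cw / ϱ)) :=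
    hℓ₂.trans (le_max_left _ _)
  have hΔ := fun K => termSecondDiffAt_box_truncRun_toClusterTower_of_analyticReadingNonexpansive (Gn K) (sp K) (Adm K) (ρA K) (A K) hγ hϱ hR (hGA K) (hA K) (hMbA K)
    (hAdmr K) (hρ₁ K) (hρ₂ K) (haw K) (hawcw K) (hAdm K) (genT1last_of_lastSectorHolo (Gn K) (sp K) (Adm K) (V K) hcS hBq (hballS K) (hholS K) (hbdS K))
    (fun _ => le_rfl) hℓ₁ (genT2last_of_lastSectorHolo (Gn K) (sp K) (Adm K) (V K) hcS hBq (hballS K) (hholS K) (hbdS K)) (fun _ => le_rfl) hℓ₂ hC1 K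
  exact ne9_EA_objectsOfRecord₁₃_of_kernelStepRate_termSecondDiff_outputBound F N θ ℓ hs hγ hlim hC₅ h5 m' M hM (fun K => truncRun K (toClusterTower (Gn K))) emb hloc sp
    hκ₀ hδ₀ hB₃ hr hM₂ hMb0 hκE hΔ
    (fun g hg K => outputBound_truncRun_toClusterTower_of_analyticReading (Gn K) (sp K) (Adm K) (ρA K) (A K) (by linarith) hMb0 (hGA K) (hMbA K) (hAdmr K) (hAdm K) K g hg)
    Ec ι Φ U hU hrU hEhol hΦemb hΦsp w hw₀ hw htail hκ₅ hω hθω hℓκ hC₉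

/-! ## §2 ★★★ The kernel-face socket -/

open Classical Finset in
/-- ★★★ **THE KERNEL-FACE SOCKET ON ROAD 2 FROM A NON-EXPANSIVE ANALYTIC READING** — §1's inputs ⟹ **`N22At (u3OfRecord₁₃ θ (objectsOfRecord₁₃ F N θ ℓ) k)` for EVERY run
length `k`** (dag-n27-c's `h22` row), by dag-n22-w3's level-free `n22At_u3OfRecord₁₃_objectsOfRecord₁₃_iff`.  LOCATED (hypothesis form); N22 NOT discharged. [folklore] -/
theorem n22At_u3OfRecord₁₃_of_kernelStepRate_genAnalyticNonexpansive (θ : Stage13Params F N) (ℓ : U3Letters₁₁) (hs : ℓ.Signs) (hγ : 0 < θ.γ)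
    (hlim : PolLimitsExistOfRecord₁₃ F N θ) {κ₅ C₅ : ℝ} (hC₅ : 0 ≤ C₅) (h5 : KernelStepRateOfRecord₁₃ F N θ κ₅ ℓ.θ₅ C₅)
    (m' : ℕ) (M : ℕ) [NeZero M] (hM : M = F.L ^ m')
    (Gn : (K : ℕ) → GenTower (F.P K) 𝔸 M) (emb : ReadingMaps F (MatA N) 𝔸)
    (hloc : Localizes17OfRecord₁₃ F N θ (fun K => truncRun K (toClusterTower (Gn K))) emb)
    (sp : (K k : ℕ) → (domSys (F.P K) M (k + 1)).Dom → Set (CPair (F.P K) 𝔸))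
    {κ κE δ₀ B₃ r R r₀ ϱ Mb cw cS Bq : ℝ} {aw : ℕ → ℕ → ℕ → ℝ}
    (hκ₀ : kappa₀ (4 * 2 ^ 4) (2 * 4) ≤ κ / 2) (hδ₀ : 0 < δ₀) (hB₃ : 0 ≤ B₃) (hr : 0 < r) (hκE : κ ≤ κE)
    (Adm : (K k : ℕ) → OlderTerms (F.P K) 𝔸 M k → Prop)
    (hAdm : ∀ K, ∀ g ∈ Window θ.γ, ∀ k, Adm K k (olderOf (recTerm (Gn K) fun n => ((g n : ℝ) : ℂ)) k))
    {Pot : ℕ → ℕ → Type*} [∀ K k, NormedAddCommGroup (Pot K k)] [∀ K k, NormedSpace ℂ (Pot K k)]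
    (ρA : (K k : ℕ) → OlderTerms (F.P K) 𝔸 M k → Pot K k) (A : (K k : ℕ) → ℝ → CPair (F.P K) 𝔸 → (domSys (F.P K) M (k + 1)).Dom → Pot K k → ℂ)
    (hGA : ∀ (K k : ℕ), ∀ t ∈ Ioc (0 : ℝ) θ.γ, ∀ (old : OlderTerms (F.P K) 𝔸 M k), Adm K k old → ∀ (X : (domSys (F.P K) M (k + 1)).Dom), ∀ φ ∈ sp K k X,
      ((Gn K) k).E ((t : ℝ) : ℂ) old φ X = A K k t φ X (ρA K k old))
    (hA : ∀ (K k : ℕ), ∀ t ∈ Ioc (0 : ℝ) θ.γ, ∀ (X : (domSys (F.P K) M (k + 1)).Dom), ∀ φ ∈ sp K k X, DifferentiableOn ℂ (A K k t φ X) (ball 0 R))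
    (hMbA : ∀ (K k : ℕ), ∀ t ∈ Ioc (0 : ℝ) θ.γ, ∀ (X : (domSys (F.P K) M (k + 1)).Dom), ∀ φ ∈ sp K k X, ∀ p ∈ ball (0 : Pot K k) R,
      ‖A K k t φ X p‖ ≤ Mb * Real.exp (-(κE * (domSys (F.P K) M (k + 1)).dj X)))
    (hAdmr : ∀ (K k : ℕ) (old : OlderTerms (F.P K) 𝔸 M k), Adm K k old → ‖ρA K k old‖ ≤ r₀)
    (hρ₁ : ∀ (K k : ℕ) (o o' : OlderTerms (F.P K) 𝔸 M k), Adm K k o → Adm K k o' → ∀ (B' : ℝ), 0 ≤ B' →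
      (∀ (k' : ℕ) (hk' : k' < k) (Y : (domSys (F.P K) M (k' + 1)).Dom), ∀ φ' ∈ sp K k' Y,
        aw K k (k' + 1) * (Real.exp (κE * (domSys (F.P K) M (k' + 1)).dj Y) * ‖o ⟨k' + 1, Nat.succ_lt_succ hk'⟩ Y φ' - o' ⟨k' + 1, Nat.succ_lt_succ hk'⟩ Y φ'‖) ≤ B') →
      ‖ρA K k o - ρA K k o'‖ ≤ B')
    (hρ₂ : ∀ (K k : ℕ) (o₁ o₂ o₃ : OlderTerms (F.P K) 𝔸 M k), Adm K k o₁ → Adm K k o₂ → Adm K k o₃ → ∀ (B' : ℝ), 0 ≤ B' →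
      (∀ (k' : ℕ) (hk' : k' < k) (Y : (domSys (F.P K) M (k' + 1)).Dom), ∀ φ' ∈ sp K k' Y,
        aw K k (k' + 1) * (Real.exp (κE * (domSys (F.P K) M (k' + 1)).dj Y) *
          ‖o₁ ⟨k' + 1, Nat.succ_lt_succ hk'⟩ Y φ' - 2 * o₂ ⟨k' + 1, Nat.succ_lt_succ hk'⟩ Y φ' + o₃ ⟨k' + 1, Nat.succ_lt_succ hk'⟩ Y φ'‖) ≤ B') →
      ‖ρA K k o₁ - (2 : ℂ) • ρA K k o₂ + ρA K k o₃‖ ≤ B')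
    (haw : ∀ K k j, 0 ≤ aw K k j) (hawcw : ∀ K k j, aw K k j ≤ cw) (hC1 : 4 * Mb * cw / ϱ < 1)
    (hMb0 : 0 ≤ Mb) (hϱ : 0 < ϱ) (hR : r₀ + ϱ < R)
    (O : ℕ → Set ℂ) (V : (K k : ℕ) → OlderTerms (F.P K) 𝔸 M k → CPair (F.P K) 𝔸 → (domSys (F.P K) M (k + 1)).Dom → ℂ) (hcS : 0 < cS) (hBq : 0 ≤ Bq)
    (hballS : ∀ K, ∀ s ∈ Ioc (0 : ℝ) θ.γ, closedBall (s : ℂ) (cS * s) ⊆ O K)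
    (hholS : ∀ (K k : ℕ) (old : OlderTerms (F.P K) 𝔸 M k), Adm K k old → ∀ (X : (domSys (F.P K) M (k + 1)).Dom), ∀ φ ∈ sp K k X,
      DifferentiableOn ℂ (fun z => ((Gn K) k).E z old φ X) (O K))
    (hbdS : ∀ (K k : ℕ) (old : OlderTerms (F.P K) 𝔸 M k), Adm K k old → ∀ (X : (domSys (F.P K) M (k + 1)).Dom), ∀ φ ∈ sp K k X, ∀ s ∈ Ioc (0 : ℝ) θ.γ,
      ∀ z ∈ closedBall (s : ℂ) (cS * s), ‖((Gn K) k).E z old φ X - V K k old φ X‖ ≤ Bq * Real.exp (-(κE * (domSys (F.P K) M (k + 1)).dj X)) * s ^ 2)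
    (Ec : ℕ → ℕ → Type*) [∀ K k, NormedAddCommGroup (Ec K k)] [∀ K k, NormedSpace ℂ (Ec K k)]
    (ι : letI := θ.instVβ₁; letI := θ.instVβ₂
      (K k : ℕ) → (domSys (F.P K) M (k + 1)).Dom → ((Fin (F.P K).d → Site (F.P K) (k + 1) → θ.Vβ) →L[ℝ] Ec K k))
    (Φ : (K k : ℕ) → (domSys (F.P K) M (k + 1)).Dom → Ec K k → CPair (F.P K) 𝔸)
    (U : (K k : ℕ) → (domSys (F.P K) M (k + 1)).Dom → Set (Ec K k)) (hU : ∀ K k X, IsOpen (U K k X)) (hrU : ∀ K k X, ball (0 : Ec K k) r ⊆ U K k X)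
    (hEhol : ∀ g ∈ Window θ.γ, ∀ (K k : ℕ) (X : (domSys (F.P K) M (k + 1)).Dom),
      DifferentiableOn ℂ (fun z => (truncRun K (toClusterTower (Gn K)) k).E (histPrefix g k) (Φ K k X z) X) (U K k X))
    (hΦemb : letI := θ.instVβ₁; letI := θ.instVβ₂
      ∀ (K k : ℕ) (X : (domSys (F.P K) M (k + 1)).Dom) (Bf : Fin (F.P K).d → Site (F.P K) (k + 1) → θ.Vβ),
        Φ K k X (ι K k X Bf) = emb K k (fun l t => NormedSpace.exp (θ.ρ8 (Bf l t))))
    (hΦsp : ∀ (K k : ℕ) (X : (domSys (F.P K) M (k + 1)).Dom), ∀ z ∈ ball (0 : Ec K k) r, Φ K k X z ∈ sp K k X)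
    (w : (K k : ℕ) → (domSys (F.P K) M (k + 1)).Dom → Site (F.P K) (k + 1) → ℝ) (hw₀ : ∀ K k X t, 0 ≤ w K k X t)
    (hw : letI := θ.instVβ₁; letI := θ.instVβ₂; letI := θ.instιβ
      ∀ (K k : ℕ) (X : (domSys (F.P K) M (k + 1)).Dom) (l : Fin (F.P K).d) (t : Site (F.P K) (k + 1)) (c : θ.ιβ),
        ‖ι K k X (Pi.single l (Pi.single t (θ.bV c)))‖ ≤ w K k X t)
    (htail : ∀ (K k : ℕ) (X : (domSys (F.P K) M (k + 1)).Dom) (t : Site (F.P K) (k + 1)),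
      let e : Site (F.P K) (k + 1) → TPt 4 (domCount (F.P K) M (k + 1) * M) := fun x i => (ZMod.cast (x i) : ZMod (domCount (F.P K) M (k + 1) * M))
      w K k X t ≤ B₃ * Real.exp (-δ₀ * distCT (domCount (F.P K) M (k + 1)) M (e t) (nearT (M := M) (e t) X)))
    (hκ₅ : delta1 δ₀ κ ((M : ℝ) * 4) ≤ κ₅)
    (hω : 0 < ℓ.ω) (hθω : ℓ.θ₅ ≤ ℓ.ω ^ 2) (hℓκ : ℓ.κ ≤ delta1 δ₀ κ ((M : ℝ) * 4))
    (hC₉ : (4 * (2 * C₅ / (1 - ℓ.θ₅) + 2 * ((16 * Mb * B₃ ^ 2 / r ^ 2) * Real.exp (delta1 δ₀ κ ((M : ℝ) * 4) * ((M : ℝ) * 4) * 3) * K₀ (4 * 2 ^ 4) (2 * 4) * K₁ 4 (δ₀ / 2))) / θ.γ +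
        ((16 * max ((6 * cS ^ 2 + 32 * cS + 64) / cS ^ 2 * Bq) (64 * Mb * cw ^ 2 / ϱ ^ 2 * (Bq * θ.γ / cS) ^ 2 / (1 - 4 * Mb * cw / ϱ)) * B₃ ^ 2 / r ^ 2) * Real.exp (delta1 δ₀ κ ((M : ℝ) * 4) * ((M : ℝ) * 4) * 3) * K₀ (4 * 2 ^ 4) (2 * 4) *
          K₁ 4 (δ₀ / 2)) * θ.γ / 2) / ℓ.ω ≤ ℓ.C₉) (k : ℕ) :
    N22At (u3OfRecord₁₃ θ (objectsOfRecord₁₃ F N θ ℓ) k) :=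
  (n22At_u3OfRecord₁₃_objectsOfRecord₁₃_iff F N θ ℓ hs k).2
    (ne9_EA_objectsOfRecord₁₃_of_kernelStepRate_genAnalyticNonexpansive F N θ ℓ hs hγ hlim hC₅ h5 m' M hM Gn emb hloc sp hκ₀ hδ₀ hB₃ hr hκE Adm hAdm ρA A hGA hA
      hMbA hAdmr hρ₁ hρ₂ haw hawcw hC1 hMb0 hϱ hR O V hcS hBq hballS hholS hbdS Ec ι Φ U hU hrU hEhol hΦemb hΦsp w hw₀ hw htail hκ₅ hω hθω hℓκ hC₉)

/-! ## §3 ★★★ The N22 pin face -/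

open Classical Finset in
/-- ★★★ **THE N22 PIN FACE ON ROAD 2 FROM A NON-EXPANSIVE ANALYTIC READING**: under K3's node-U3 pin at the tuple (`hpin`), §1's inputs at `θ.toStage13Params` give
`N22At (rateCarriersOfRecord₁₃CoPH 𝔯 F θ hP g₀ os k).u3` for EVERY run length `k`.  LOCATED (hypothesis form); N22 NOT discharged. [folklore] -/
theorem n22At_rateCarriers_of_kernels_pin_of_kernelStepRate_genAnalyticNonexpansive (𝔯 : RateReading₁₃CoPH N) (θ : Stage13HParams F N) (hP : θ.Provisos₁₃CoPH F N)
    (g₀ : ℕ → ℝ) (os : List (ULoop F)) (ℓ : U3Letters₁₁) (hs : ℓ.Signs) (hγ : 0 < θ.γ)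
    (hpin : (𝔯.lit F θ hP g₀ os).u3 = objectsOfRecord₁₃ F N θ.toStage13Params ℓ)
    (hlim : PolLimitsExistOfRecord₁₃ F N θ.toStage13Params) {κ₅ C₅ : ℝ} (hC₅ : 0 ≤ C₅) (h5 : KernelStepRateOfRecord₁₃ F N θ.toStage13Params κ₅ ℓ.θ₅ C₅)
    (m' : ℕ) (M : ℕ) [NeZero M] (hM : M = F.L ^ m')
    (Gn : (K : ℕ) → GenTower (F.P K) 𝔸 M) (emb : ReadingMaps F (MatA N) 𝔸) (hloc : Localizes17OfRecord₁₃ F N θ.toStage13Params (fun K => truncRun K (toClusterTower (Gn K))) emb)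
    (sp : (K k : ℕ) → (domSys (F.P K) M (k + 1)).Dom → Set (CPair (F.P K) 𝔸))
    {κ κE δ₀ B₃ r R r₀ ϱ Mb cw cS Bq : ℝ} {aw : ℕ → ℕ → ℕ → ℝ}
    (hκ₀ : kappa₀ (4 * 2 ^ 4) (2 * 4) ≤ κ / 2) (hδ₀ : 0 < δ₀) (hB₃ : 0 ≤ B₃) (hr : 0 < r) (hκE : κ ≤ κE)
    (Adm : (K k : ℕ) → OlderTerms (F.P K) 𝔸 M k → Prop)
    (hAdm : ∀ K, ∀ g ∈ Window θ.γ, ∀ k, Adm K k (olderOf (recTerm (Gn K) fun n => ((g n : ℝ) : ℂ)) k))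
    {Pot : ℕ → ℕ → Type*} [∀ K k, NormedAddCommGroup (Pot K k)] [∀ K k, NormedSpace ℂ (Pot K k)]
    (ρA : (K k : ℕ) → OlderTerms (F.P K) 𝔸 M k → Pot K k) (A : (K k : ℕ) → ℝ → CPair (F.P K) 𝔸 → (domSys (F.P K) M (k + 1)).Dom → Pot K k → ℂ)
    (hGA : ∀ (K k : ℕ), ∀ t ∈ Ioc (0 : ℝ) θ.γ, ∀ (old : OlderTerms (F.P K) 𝔸 M k), Adm K k old → ∀ (X : (domSys (F.P K) M (k + 1)).Dom), ∀ φ ∈ sp K k X,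
      ((Gn K) k).E ((t : ℝ) : ℂ) old φ X = A K k t φ X (ρA K k old))
    (hA : ∀ (K k : ℕ), ∀ t ∈ Ioc (0 : ℝ) θ.γ, ∀ (X : (domSys (F.P K) M (k + 1)).Dom), ∀ φ ∈ sp K k X, DifferentiableOn ℂ (A K k t φ X) (ball 0 R))
    (hMbA : ∀ (K k : ℕ), ∀ t ∈ Ioc (0 : ℝ) θ.γ, ∀ (X : (domSys (F.P K) M (k + 1)).Dom), ∀ φ ∈ sp K k X, ∀ p ∈ ball (0 : Pot K k) R,
      ‖A K k t φ X p‖ ≤ Mb * Real.exp (-(κE * (domSys (F.P K) M (k + 1)).dj X)))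
    (hAdmr : ∀ (K k : ℕ) (old : OlderTerms (F.P K) 𝔸 M k), Adm K k old → ‖ρA K k old‖ ≤ r₀)
    (hρ₁ : ∀ (K k : ℕ) (o o' : OlderTerms (F.P K) 𝔸 M k), Adm K k o → Adm K k o' → ∀ (B' : ℝ), 0 ≤ B' →
      (∀ (k' : ℕ) (hk' : k' < k) (Y : (domSys (F.P K) M (k' + 1)).Dom), ∀ φ' ∈ sp K k' Y,
        aw K k (k' + 1) * (Real.exp (κE * (domSys (F.P K) M (k' + 1)).dj Y) * ‖o ⟨k' + 1, Nat.succ_lt_succ hk'⟩ Y φ' - o' ⟨k' + 1, Nat.succ_lt_succ hk'⟩ Y φ'‖) ≤ B') →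
      ‖ρA K k o - ρA K k o'‖ ≤ B')
    (hρ₂ : ∀ (K k : ℕ) (o₁ o₂ o₃ : OlderTerms (F.P K) 𝔸 M k), Adm K k o₁ → Adm K k o₂ → Adm K k o₃ → ∀ (B' : ℝ), 0 ≤ B' →
      (∀ (k' : ℕ) (hk' : k' < k) (Y : (domSys (F.P K) M (k' + 1)).Dom), ∀ φ' ∈ sp K k' Y,
        aw K k (k' + 1) * (Real.exp (κE * (domSys (F.P K) M (k' + 1)).dj Y) *
          ‖o₁ ⟨k' + 1, Nat.succ_lt_succ hk'⟩ Y φ' - 2 * o₂ ⟨k' + 1, Nat.succ_lt_succ hk'⟩ Y φ' + o₃ ⟨k' + 1, Nat.succ_lt_succ hk'⟩ Y φ'‖) ≤ B') →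
      ‖ρA K k o₁ - (2 : ℂ) • ρA K k o₂ + ρA K k o₃‖ ≤ B')
    (haw : ∀ K k j, 0 ≤ aw K k j) (hawcw : ∀ K k j, aw K k j ≤ cw) (hC1 : 4 * Mb * cw / ϱ < 1)
    (hMb0 : 0 ≤ Mb) (hϱ : 0 < ϱ) (hR : r₀ + ϱ < R)
    (O : ℕ → Set ℂ) (V : (K k : ℕ) → OlderTerms (F.P K) 𝔸 M k → CPair (F.P K) 𝔸 → (domSys (F.P K) M (k + 1)).Dom → ℂ) (hcS : 0 < cS) (hBq : 0 ≤ Bq)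
    (hballS : ∀ K, ∀ s ∈ Ioc (0 : ℝ) θ.γ, closedBall (s : ℂ) (cS * s) ⊆ O K)
    (hholS : ∀ (K k : ℕ) (old : OlderTerms (F.P K) 𝔸 M k), Adm K k old → ∀ (X : (domSys (F.P K) M (k + 1)).Dom), ∀ φ ∈ sp K k X,
      DifferentiableOn ℂ (fun z => ((Gn K) k).E z old φ X) (O K))
    (hbdS : ∀ (K k : ℕ) (old : OlderTerms (F.P K) 𝔸 M k), Adm K k old → ∀ (X : (domSys (F.P K) M (k + 1)).Dom), ∀ φ ∈ sp K k X, ∀ s ∈ Ioc (0 : ℝ) θ.γ,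
      ∀ z ∈ closedBall (s : ℂ) (cS * s), ‖((Gn K) k).E z old φ X - V K k old φ X‖ ≤ Bq * Real.exp (-(κE * (domSys (F.P K) M (k + 1)).dj X)) * s ^ 2)
    (Ec : ℕ → ℕ → Type*) [∀ K k, NormedAddCommGroup (Ec K k)] [∀ K k, NormedSpace ℂ (Ec K k)]
    (ι : letI := θ.instVβ₁; letI := θ.instVβ₂
      (K k : ℕ) → (domSys (F.P K) M (k + 1)).Dom → ((Fin (F.P K).d → Site (F.P K) (k + 1) → θ.Vβ) →L[ℝ] Ec K k))
    (Φ : (K k : ℕ) → (domSys (F.P K) M (k + 1)).Dom → Ec K k → CPair (F.P K) 𝔸)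
    (U : (K k : ℕ) → (domSys (F.P K) M (k + 1)).Dom → Set (Ec K k)) (hU : ∀ K k X, IsOpen (U K k X)) (hrU : ∀ K k X, ball (0 : Ec K k) r ⊆ U K k X)
    (hEhol : ∀ g ∈ Window θ.γ, ∀ (K k : ℕ) (X : (domSys (F.P K) M (k + 1)).Dom),
      DifferentiableOn ℂ (fun z => (truncRun K (toClusterTower (Gn K)) k).E (histPrefix g k) (Φ K k X z) X) (U K k X))
    (hΦemb : letI := θ.instVβ₁; letI := θ.instVβ₂
      ∀ (K k : ℕ) (X : (domSys (F.P K) M (k + 1)).Dom) (Bf : Fin (F.P K).d → Site (F.P K) (k + 1) → θ.Vβ),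
        Φ K k X (ι K k X Bf) = emb K k (fun l t => NormedSpace.exp (θ.ρ8 (Bf l t))))
    (hΦsp : ∀ (K k : ℕ) (X : (domSys (F.P K) M (k + 1)).Dom), ∀ z ∈ ball (0 : Ec K k) r, Φ K k X z ∈ sp K k X)
    (w : (K k : ℕ) → (domSys (F.P K) M (k + 1)).Dom → Site (F.P K) (k + 1) → ℝ) (hw₀ : ∀ K k X t, 0 ≤ w K k X t)
    (hw : letI := θ.instVβ₁; letI := θ.instVβ₂; letI := θ.instιβ
      ∀ (K k : ℕ) (X : (domSys (F.P K) M (k + 1)).Dom) (l : Fin (F.P K).d) (t : Site (F.P K) (k + 1)) (c : θ.ιβ),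
        ‖ι K k X (Pi.single l (Pi.single t (θ.bV c)))‖ ≤ w K k X t)
    (htail : ∀ (K k : ℕ) (X : (domSys (F.P K) M (k + 1)).Dom) (t : Site (F.P K) (k + 1)),
      let e : Site (F.P K) (k + 1) → TPt 4 (domCount (F.P K) M (k + 1) * M) := fun x i => (ZMod.cast (x i) : ZMod (domCount (F.P K) M (k + 1) * M))
      w K k X t ≤ B₃ * Real.exp (-δ₀ * distCT (domCount (F.P K) M (k + 1)) M (e t) (nearT (M := M) (e t) X)))
    (hκ₅ : delta1 δ₀ κ ((M : ℝ) * 4) ≤ κ₅)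
    (hω : 0 < ℓ.ω) (hθω : ℓ.θ₅ ≤ ℓ.ω ^ 2) (hℓκ : ℓ.κ ≤ delta1 δ₀ κ ((M : ℝ) * 4))
    (hC₉ : (4 * (2 * C₅ / (1 - ℓ.θ₅) + 2 * ((16 * Mb * B₃ ^ 2 / r ^ 2) * Real.exp (delta1 δ₀ κ ((M : ℝ) * 4) * ((M : ℝ) * 4) * 3) * K₀ (4 * 2 ^ 4) (2 * 4) * K₁ 4 (δ₀ / 2))) / θ.γ +
        ((16 * max ((6 * cS ^ 2 + 32 * cS + 64) / cS ^ 2 * Bq) (64 * Mb * cw ^ 2 / ϱ ^ 2 * (Bq * θ.γ / cS) ^ 2 / (1 - 4 * Mb * cw / ϱ)) * B₃ ^ 2 / r ^ 2) * Real.exp (delta1 δ₀ κ ((M : ℝ) * 4) * ((M : ℝ) * 4) * 3) * K₀ (4 * 2 ^ 4) (2 * 4) *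
          K₁ 4 (δ₀ / 2)) * θ.γ / 2) / ℓ.ω ≤ ℓ.C₉) (k : ℕ) :
    N22At (rateCarriersOfRecord₁₃CoPH 𝔯 F θ hP g₀ os k).u3 :=
  n22At_rateCarriers_of_kernels_pin_of_ne9 𝔯 θ hP g₀ os ℓ hs hpin
    (ne9_EA_objectsOfRecord₁₃_of_kernelStepRate_genAnalyticNonexpansive F N θ.toStage13Params ℓ hs hγ hlim hC₅ h5 m' M hM Gn emb hloc sp hκ₀ hδ₀ hB₃ hr hκE Adm hAdm ρA A hGA hA
      hMbA hAdmr hρ₁ hρ₂ haw hawcw hC1 hMb0 hϱ hR O V hcS hBq hballS hholS hbdS Ec ι Φ U hU hrU hEhol hΦemb hΦsp w hw₀ hw htail hκ₅ hω hθω hℓκ hC₉) k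

end YMDAG.N22.KernelFading

end
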